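import Literature.AlgebraicGeometry.GroupSchemes.AffineGroupSchemeSpecPoints
import Literature.AlgebraicGeometry.GroupSchemes.GeneralLinearGroupSchemeBaseChange
import HarnessLib

/-!
# Base change of an affine group scheme over a ring: points over `R″`-algebras and the algebra maps of `Γ`

Layer `Literature/AlgebraicGeometry/GroupSchemes`, namespace `Literature.AlgebraicGeometry.GroupSchemes.AffineGroupScheme` (continues ★
`AffineGroupSchemeHopfAlgebra` p844646 ∕ ★ `AffineGroupSchemeSpecPoints` p844773).  Two small `def`s (`mapSpecOverIso`, `baseChangePtMulEquiv`) +
theorems; no instance, no notation, no named fact, no `sorry`.  Cell `hodgecm-mathlib` (D-0151), programme P6 «MOD», HEART organ (GAP-1)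
clause «base change» of F0P6b-plan (g0)'s CENSUS-P6b-HEART-b1b3b4 §0 (points half; the Hopf-algebra identification
`Γ(G_{R′}) ≅ R′ ⊗_R Γ(G)` is the sequel); B-p04 (g36).  Count-neutral Mathlib-side capital: HC_CM is proved only modulo the 7 printed
citations until rung 0 closes; nothing here bears on it.

[GortzWedhorn2020] (4.7.1), (4.15) «`(G ×_S S′)_{S′}(T) = G_S(T)` as groups»; [GortzWedhorn2023] §(27.2).  For a commutative ring `R`, an
`R`-algebra `R′` and a group object `G` of `SchemeOver R`, the base change `G_{R′} := (Over.pullback (Spec R′ → Spec R)).obj G` carries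
Mathlib's transported group structure (`Functor.grpObjObj`, scoped instance `CategoryTheory.Obj`).  For every commutative `R′`-algebra `R″`
(an `R`-algebra through the tower):

* §1 `mapSpecOverIso : (Over.map (Spec R′ → Spec R)).obj (specOver R′ R″) ≅ specOver R R″` (the test object `Spec R″` seen over `R`);
* §2 **`baseChangePtMulEquiv G R′ R″ : (specOver R′ R″ ⟶ G_{R′}) ≃* (specOver R R″ ⟶ G)`** — the `R″`-points of the base change ARE the
  `R″`-points of `G`, AS GROUPS (★ `adjunctionHomMulEquiv` for Mathlib `Over.mapPullbackAdj`);
* §3 for `G` affine: `G_{R′}` is affine (`isAffine_pullback_obj_left`) and, composing with ★ `ptEquiv` on both sides,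
  **`algHomEquivBaseChange : (Alg G_{R′} →ₐ[R′] R″) ≃ (Alg G →ₐ[R] R″)`**, natural in `R″` (`algHomEquivBaseChange_comp`) and compatible with
  the two functorial group laws (`algHomEquivBaseChange_mul`) — i.e. `Γ(G_{R′})` and `R′ ⊗_R Γ(G)` corepresent the SAME group-valued functor
  on `R′`-algebras (the Yoneda form of `Γ(G_{R′}) ≅ R′ ⊗_R Γ(G)` as Hopf algebras).

## References
* [GortzWedhorn2020] U. Görtz, T. Wedhorn, *Algebraic Geometry I*, 2nd ed. (2020), (4.7.1) (p. 108), (4.15) (p. 116).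
* [GortzWedhorn2023] U. Görtz, T. Wedhorn, *Algebraic Geometry II* (2023), §(27.2) (pp. 606–607).
-/

set_option autoImplicit false

-- Mathlib's `Over`/`Scheme` APIs are stated across semireducible wrappers (as in the ★ `GroupSchemes/*` files).
set_option backward.isDefEq.respectTransparency false

universe u

open CategoryTheory CategoryTheory.Limits AlgebraicGeometry MonoidalCategory CartesianMonoidalCategory TensorProduct WithConv

noncomputable section

namespace Literature.AlgebraicGeometry.GroupSchemes

namespace AffineGroupScheme

open scoped MonObj CategoryTheory.Obj

open Literature.AlgebraicGeometry.Motives Literature.NumberTheory.DiophantineGeometry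

variable {R : Type u} [CommRing R] (R' : Type u) [CommRing R'] [Algebra R R'] (R'' : Type u) [CommRing R''] [Algebra R R'']
  [Algebra R' R''] [IsScalarTower R R' R'']

/-! ## §1 The test object `Spec R″` over `R′`, seen over `R` -/

/-- **`Spec R″ → Spec R′ → Spec R` is `specOver R R″`** (tower `R → R′ → R″`; `Spec` of a composite).
[cite: GortzWedhorn2020, Section (4.7), (4.7.1) (p. 108)] -/
def mapSpecOverIso :
    (Over.map (Spec.map (CommRingCat.ofHom (algebraMap R R')))).obj (specOver R' R'') ≅ specOver R R'' :=
  Over.isoMk (Iso.refl _) (by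
    change 𝟙 _ ≫ Spec.map (CommRingCat.ofHom (algebraMap R R'')) =
      Spec.map (CommRingCat.ofHom (algebraMap R' R'')) ≫ Spec.map (CommRingCat.ofHom (algebraMap R R'))
    rw [Category.id_comp, ← Spec.map_comp, ← CommRingCat.ofHom_comp, ← IsScalarTower.algebraMap_eq])

/-- Its underlying morphism is the identity of `Spec R″`. [cite: GortzWedhorn2020, Section (4.7), (4.7.1) (p. 108)] -/
theorem mapSpecOverIso_hom_left : (mapSpecOverIso (R := R) R' R'').hom.left = 𝟙 (Spec (CommRingCat.of R'')) := rfl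

/-! ## §2 `R″`-points of the base change are `R″`-points, as groups -/

section Points

variable (G : SchemeOver R) [GrpObj G]

/-- **`G_{R′}(Spec R″) ≃* G(Spec R″)`**: the points of the base change `(Over.pullback (Spec R′ → Spec R)).obj G` over a commutative
`R′`-algebra `R″` are the points of `G` over `R″`, multiplicatively for Mathlib's `Hom.group` on both sides (transposition along
`Over.mapPullbackAdj`, ★ `adjunctionHomMulEquiv`, then §1). [cite: GortzWedhorn2020, (4.15) and Definition 4.42, p. 116] -/
def baseChangePtMulEquiv :
    (specOver R' R'' ⟶ (Over.pullback (Spec.map (CommRingCat.ofHom (algebraMap R R')))).obj G) ≃* (specOver R R'' ⟶ G) :=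
  (adjunctionHomMulEquiv (Over.mapPullbackAdj (Spec.map (CommRingCat.ofHom (algebraMap R R')))) (specOver R' R'') G).symm.trans
    { toFun := fun u => (mapSpecOverIso R' R'').inv ≫ u
      invFun := fun v => (mapSpecOverIso R' R'').hom ≫ v
      left_inv := fun u => by
        change (mapSpecOverIso R' R'').hom ≫ (mapSpecOverIso R' R'').inv ≫ u = u
        rw [Iso.hom_inv_id_assoc]
      right_inv := fun v => by
        change (mapSpecOverIso R' R'').inv ≫ (mapSpecOverIso R' R'').hom ≫ v = v
        rw [Iso.inv_hom_id_assoc]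
      map_mul' := fun u v => MonObj.comp_mul _ _ _ }

end Points

/-! ## §3 Affine `G`: the algebra maps of `Γ(G_{R′})` over `R′` are those of `Γ(G)` over `R` -/

section Alg

variable (G : SchemeOver R) [IsAffine G.left]

/-- The base change of an affine `R`-scheme to `R′` is affine. [cite: GortzWedhorn2023, §(27.2) (p. 606)] -/
theorem isAffine_pullback_obj_left :
    IsAffine ((Over.pullback (Spec.map (CommRingCat.ofHom (algebraMap R R')))).obj G).left :=
  inferInstanceAs (IsAffine (pullback G.hom (Spec.map (CommRingCat.ofHom (algebraMap R R')))))

variable [GrpObj G] [IsAffine ((Over.pullback (Spec.map (CommRingCat.ofHom (algebraMap R R')))).obj G).left]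

/-- **`Hom_{R′-alg}(Γ(G_{R′}), R″) ≃ Hom_{R-alg}(Γ(G), R″)`** for every commutative `R′`-algebra `R″`: both sides are the `R″`-points
(★ `ptEquiv` on both sides of `baseChangePtMulEquiv`).  This is the Yoneda form of `Γ(G_{R′}) ≅ R′ ⊗_R Γ(G)`.
[cite: GortzWedhorn2023, §(27.2) (pp. 606–607)] -/
def algHomEquivBaseChange :
    (Alg ((Over.pullback (Spec.map (CommRingCat.ofHom (algebraMap R R')))).obj G) →ₐ[R'] R'') ≃ (Alg G →ₐ[R] R'') :=
  ((ptEquiv ((Over.pullback (Spec.map (CommRingCat.ofHom (algebraMap R R')))).obj G) R'').symm.trans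
    (baseChangePtMulEquiv R' R'' G).toEquiv).trans (ptEquiv G R'')

/-- Unfolding `algHomEquivBaseChange`. [cite: GortzWedhorn2023, §(27.2) (pp. 606–607)] -/
theorem algHomEquivBaseChange_apply (φ : Alg ((Over.pullback (Spec.map (CommRingCat.ofHom (algebraMap R R')))).obj G) →ₐ[R'] R'') :
    algHomEquivBaseChange R' R'' G φ =
      ptEquiv G R'' (baseChangePtMulEquiv R' R'' G
        ((ptEquiv ((Over.pullback (Spec.map (CommRingCat.ofHom (algebraMap R R')))).obj G) R'').symm φ)) := rfl

/-- **Compatibility with the group laws**: `algHomEquivBaseChange` intertwines the functorial group law of `Γ(G_{R′})` (over `R′`) with that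
of `Γ(G)` (over `R`) on `R″`-points. [cite: GortzWedhorn2023, §(27.2) (27.2.1) (pp. 606–607)] -/
theorem algHomEquivBaseChange_mul
    (φ χ : Alg ((Over.pullback (Spec.map (CommRingCat.ofHom (algebraMap R R')))).obj G) →ₐ[R'] R'') :
    algHomEquivBaseChange R' R'' G
        ((groupLaw ((Over.pullback (Spec.map (CommRingCat.ofHom (algebraMap R R')))).obj G)).mul φ χ) =
      (groupLaw G).mul (algHomEquivBaseChange R' R'' G φ) (algHomEquivBaseChange R' R'' G χ) := by
  obtain ⟨u, rfl⟩ := (ptEquiv ((Over.pullback (Spec.map (CommRingCat.ofHom (algebraMap R R')))).obj G) R'').surjective φ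
  obtain ⟨v, rfl⟩ := (ptEquiv ((Over.pullback (Spec.map (CommRingCat.ofHom (algebraMap R R')))).obj G) R'').surjective χ
  rw [groupLaw_mul_apply, algHomEquivBaseChange_apply, algHomEquivBaseChange_apply, algHomEquivBaseChange_apply,
    Equiv.symm_apply_apply, Equiv.symm_apply_apply, Equiv.symm_apply_apply, map_mul, groupLaw_mul_apply]

/-- `algHomEquivBaseChange` sends the unit point to the unit point. [cite: GortzWedhorn2023, §(27.2) (27.2.1) (pp. 606–607)] -/
theorem algHomEquivBaseChange_one :
    algHomEquivBaseChange R' R'' G ((groupLaw ((Over.pullback (Spec.map (CommRingCat.ofHom (algebraMap R R')))).obj G)).one R'') =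
      (groupLaw G).one R'' := by
  rw [groupLaw_one, groupLaw_one, algHomEquivBaseChange_apply, Equiv.symm_apply_apply, map_one]

end Alg

/-! ## §4 Naturality in the test algebra `R″` -/

section Naturality

variable {R' R''} (G : SchemeOver R) [GrpObj G] {R₃ : Type u} [CommRing R₃] [Algebra R R₃] [Algebra R' R₃] [IsScalarTower R R' R₃]

/-- `Spec` of an `R′`-algebra map `ψ : R″ → R‴`, seen over `R` through `mapSpecOverIso`, is `Spec` of `ψ` restricted to `R`.
[cite: GortzWedhorn2020, Section (4.7), (4.7.1) (p. 108)] -/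
theorem mapSpecOverIso_inv_comp_map_specOverMapOfAlgHom (ψ : R'' →ₐ[R'] R₃) :
    (mapSpecOverIso (R := R) R' R₃).inv ≫
        (Over.map (Spec.map (CommRingCat.ofHom (algebraMap R R')))).map (AlgPoints.specOverMapOfAlgHom ψ) =
      AlgPoints.specOverMapOfAlgHom (ψ.restrictScalars R) ≫ (mapSpecOverIso (R := R) R' R'').inv := by
  ext : 1
  change 𝟙 _ ≫ Spec.map (CommRingCat.ofHom ψ.toRingHom) = Spec.map (CommRingCat.ofHom (ψ.restrictScalars R).toRingHom) ≫ 𝟙 _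
  rw [Category.id_comp, Category.comp_id]
  rfl

/-- **`baseChangePtMulEquiv` is natural in the test object**: precomposing a point of `G_{R′}` with `Spec ψ` (over `R′`) precomposes its
image with `Spec (ψ|_R)` (over `R`). [cite: GortzWedhorn2020, (4.15) and Definition 4.42, p. 116] -/
theorem baseChangePtMulEquiv_comp (ψ : R'' →ₐ[R'] R₃)
    (u : specOver R' R'' ⟶ (Over.pullback (Spec.map (CommRingCat.ofHom (algebraMap R R')))).obj G) :
    baseChangePtMulEquiv R' R₃ G (AlgPoints.specOverMapOfAlgHom ψ ≫ u) =
      AlgPoints.specOverMapOfAlgHom (ψ.restrictScalars R) ≫ baseChangePtMulEquiv R' R'' G u := by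
  change (mapSpecOverIso R' R₃).inv ≫ ((Over.mapPullbackAdj _).homEquiv _ _).symm (AlgPoints.specOverMapOfAlgHom ψ ≫ u) =
    AlgPoints.specOverMapOfAlgHom (ψ.restrictScalars R) ≫ (mapSpecOverIso R' R'').inv ≫ ((Over.mapPullbackAdj _).homEquiv _ _).symm u
  rw [Adjunction.homEquiv_naturality_left_symm, ← Category.assoc, mapSpecOverIso_inv_comp_map_specOverMapOfAlgHom, Category.assoc]

variable [IsAffine G.left] [IsAffine ((Over.pullback (Spec.map (CommRingCat.ofHom (algebraMap R R')))).obj G).left]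

/-- **`algHomEquivBaseChange` is natural in the `R′`-algebra `R″`**: for `ψ : R″ →ₐ[R′] R‴`,
`algHomEquivBaseChange (ψ ∘ φ) = (ψ|_R) ∘ algHomEquivBaseChange φ` (★ `ptEquiv_comap` on both sides of `baseChangePtMulEquiv_comp`).
[cite: GortzWedhorn2023, §(27.2) (pp. 606–607)] -/
theorem algHomEquivBaseChange_comp (ψ : R'' →ₐ[R'] R₃)
    (φ : Alg ((Over.pullback (Spec.map (CommRingCat.ofHom (algebraMap R R')))).obj G) →ₐ[R'] R'') :
    algHomEquivBaseChange R' R₃ G (ψ.comp φ) = (ψ.restrictScalars R).comp (algHomEquivBaseChange R' R'' G φ) := by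
  obtain ⟨u, rfl⟩ := (ptEquiv ((Over.pullback (Spec.map (CommRingCat.ofHom (algebraMap R R')))).obj G) R'').surjective φ
  rw [algHomEquivBaseChange_apply, algHomEquivBaseChange_apply, Equiv.symm_apply_apply, ← ptEquiv_comap, Equiv.symm_apply_apply,
    baseChangePtMulEquiv_comp, ptEquiv_comap]

end Naturality

end AffineGroupScheme

end Literature.AlgebraicGeometry.GroupSchemes

end
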